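import Literature.IUT.HodgeTheaters.PiAvatarOrbitCategory
import HarnessLib

/-!
# The OUTER-HOMOMORPHISM hom-type between embedded objects of the Π-avatar ([IUTchI] §0: morphisms of connected temperoids / anabelioids =
# continuous outer homomorphisms) — the hom-TYPE twin needed at `v̲ ∈ V̲^bad` for Example 4.4's `φ^Θ_{v̲_j}` (junction J-Θ-1, design decision D-JΘ1-1:
# twin ONLY the bad-place hom-type; group-theoretic plumbing, no content of the series)

S. Mochizuki, *Inter-universal Teichmüller theory I*, kurims manuscript (May 2020), §0 «Categories» pp. 33–35 (connected temperoids `ℬ^temp(Π)⁰`, p. 34 l. 40–46; a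
morphism of connected temperoids corresponds to a continuous OUTER homomorphism of the fundamental groups), Ex 4.4 (i) pp. 106–107 («the various morphisms
`ℬ^temp(Π_v̲)⁰ → ℬ^temp(Π_v̲)⁰` that arise [i.e., via composition with the natural surjection `Π_v̲ ↠ G_v̲`] from the evaluation sections labeled `j`»)
([IUTchI] Ex 4.4 (i) p.106) [claim: Mochizuki2012, status: disputed] (D-0012 claim key, series status DISPUTED — this file is GROUP THEORY over one ambient group
`A` (abc-iut-L5-t4's `OrbitCat A`, design D1 EMBEDDED); nothing of the series is asserted, no side is taken on [IUTchIII] Cor. 3.12).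

WHY (L5-lead RULINGS #79 (3) / #82 (1), file (A) of the J-Θ-1 repair; STEP-0 memo HOME/staging/L5/L5-t3/STEP0-JTheta1-AmbTheta-g6.md).  In the orbit category
`OrbitCat A` every morphism `ℬ(H)⁰ → ℬ(H′)⁰` is a coset map `xH ↦ xdH′` (`OrbitCat.exists_eq_homOfElem`) — an INJECTIVE-type outer homomorphism `h ↦ d⁻¹hd`;
print's `φ^Θ_{v̲_j}` at a bad place is the NON-injective outer homomorphism `s_j ∘ (Π_v̲ ↠ G_v̲)` (junction finding J-Θ-1, abc-iut-L5-t3 p452433; the kernel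
obstruction theorems are abc-iut-w4-d054's `PiAvatarThetaBridgeObstruction.lean`, cited BY NAME).  This file supplies the wider hom-TYPE, instance-free:
* `OuterHom H H′` := group homomorphisms `H →* H′` modulo inner automorphisms of `H′`; `OuterHom.id`, `OuterHom.comp` with the category laws as theorems;
* `OuterHom.ofConj d` (the class of `h ↦ d⁻¹hd` for `d⁻¹Hd ≤ H′`; independent of the representative of `dH′`) and `OrbitCat.toOuter` (a morphism of the orbit
  category ↦ its conjugation class), compatible with composition; `ofHom` (ANY homomorphism, e.g. `s ∘ aug`, gives a class);
* `OuterHom.IsOver aug` — «over `G`»: `aug ∘ φ = c_g ∘ aug|_H` for some `g` (the ADOPTED hom shape: coset maps and section-composites both qualify);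
* faithfulness of `toOuter` under an explicit SLIMNESS hypothesis (trivial centraliser; print: slimness of `Π_v̲`, [AbsTopI] §1) — `toOuter_injective_of_centralizer_eq_bot`;
* the RIGIDITY binder shape `OuterRigid InPlay` («every outer ISOmorphism between objects in play is the class of a coset isomorphism»; print locus Def 6.1 (ii)/(iii),
  [AbsTopIII] Thm 1.9 / [EtTh] Prop 2.4) — a PREDICATE, named not asserted.
STATUS OF RECORD (L5-lead RULINGS #84): the Π-avatar `EvalBinder`/`KitCore` route (abc-iut-L5-t3 p452433/p453062) is VACUOUS at CLOSED `Π_v̲` — abc-iut-w4-d054's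
`PiAvatarKitCoreObstruction.lean` (p456090: for closed `H` in the profinite ambient `a⁻¹Ha ≤ H ⇒ a ∈ N(H)`, so every endomorphism of `𝒟_v̲` in the orbit category is an
automorphism and no label-rigid `EvalBinder` exists); THIS module (with `PiAvatarEvalSections`) is the NON-vacuous typing of the bad-place hom-type (D-JΘ1-1 (iv-c)).
No instance, no notation; typed ≠ proved elsewhere; binder ≠ fact.
-/

namespace Literature.IUT.HodgeTheaters

open CategoryTheory

universe u

variable {A : Type u} [Group A]

/-! ### Homomorphisms between subgroups modulo inner automorphisms of the target -/

/-- Two homomorphisms `H → H′` are INNER-EQUIVALENT if they differ by conjugation by an element of `H′` ([IUTchI] §0: outer homomorphisms).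
([IUTchI] §0 p.33) [claim: Mochizuki2012, status: disputed] -/
def InnerEquiv (H H' : Subgroup A) (φ ψ : H →* H') : Prop := ∃ c : H', ∀ x, ψ x = c * φ x * c⁻¹

/-- Inner equivalence is reflexive. ([IUTchI] §0 p.33) [claim: Mochizuki2012, status: disputed] -/
theorem InnerEquiv.refl {H H' : Subgroup A} (φ : H →* H') : InnerEquiv H H' φ φ := ⟨1, fun x => by simp⟩

/-- Inner equivalence is symmetric. ([IUTchI] §0 p.33) [claim: Mochizuki2012, status: disputed] -/
theorem InnerEquiv.symm {H H' : Subgroup A} {φ ψ : H →* H'} (h : InnerEquiv H H' φ ψ) : InnerEquiv H H' ψ φ := by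
  obtain ⟨c, hc⟩ := h
  refine ⟨c⁻¹, fun x => ?_⟩
  rw [hc x]; group

/-- Inner equivalence is transitive. ([IUTchI] §0 p.33) [claim: Mochizuki2012, status: disputed] -/
theorem InnerEquiv.trans {H H' : Subgroup A} {φ ψ χ : H →* H'} (h₁ : InnerEquiv H H' φ ψ) (h₂ : InnerEquiv H H' ψ χ) :
    InnerEquiv H H' φ χ := by
  obtain ⟨c, hc⟩ := h₁
  obtain ⟨c', hc'⟩ := h₂
  refine ⟨c' * c, fun x => ?_⟩
  rw [hc' x, hc x]; group

/-- The setoid of inner equivalence on `H →* H′`. ([IUTchI] §0 p.33) [claim: Mochizuki2012, status: disputed] -/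
def innerSetoid (H H' : Subgroup A) : Setoid (H →* H') where
  r := InnerEquiv H H'
  iseqv := ⟨InnerEquiv.refl, InnerEquiv.symm, InnerEquiv.trans⟩

/-- **`OuterHom H H′` — the OUTER homomorphisms `ℬ(H)⁰ → ℬ(H′)⁰`**: homomorphisms `H → H′` modulo inner automorphisms of `H′` ([IUTchI] §0: the morphisms of
connected temperoids/anabelioids; continuity is not modelled in the abstract-group avatar).  The hom-type twin of `OrbitCat`'s coset maps needed for Example
4.4's `φ^Θ_{v̲_j}` at `v̲ ∈ V̲^bad` (J-Θ-1). ([IUTchI] §0 p.33) [claim: Mochizuki2012, status: disputed] -/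
def OuterHom (H H' : Subgroup A) : Type u := Quotient (innerSetoid H H')

namespace OuterHom

variable {H H' H'' H''' : Subgroup A}

/-- The class of a homomorphism (ANY homomorphism: e.g. a section composed with a surjection). ([IUTchI] §0 p.33) [claim: Mochizuki2012, status: disputed] -/
def ofHom (φ : H →* H') : OuterHom H H' := Quotient.mk (innerSetoid H H') φ

/-- Every class has a representative. ([IUTchI] §0 p.33) [claim: Mochizuki2012, status: disputed] -/
theorem ofHom_surjective : Function.Surjective (ofHom : (H →* H') → OuterHom H H') := Quotient.mk_surjective

/-- Two homomorphisms have the same class iff they are inner-equivalent. ([IUTchI] §0 p.33) [claim: Mochizuki2012, status: disputed] -/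
theorem ofHom_eq_ofHom_iff (φ ψ : H →* H') : ofHom φ = ofHom ψ ↔ ∃ c : H', ∀ x, ψ x = c * φ x * c⁻¹ :=
  Quotient.eq (r := innerSetoid H H')

/-- The identity outer homomorphism. ([IUTchI] §0 p.33) [claim: Mochizuki2012, status: disputed] -/
def id (H : Subgroup A) : OuterHom H H := ofHom (MonoidHom.id H)

/-- Composition of outer homomorphisms (well defined: `ψ ∘ (c_{h′} ∘ φ) = c_{ψ h′} ∘ (ψ ∘ φ)`). ([IUTchI] §0 p.33) [claim: Mochizuki2012, status: disputed] -/
def comp (f : OuterHom H H') (g : OuterHom H' H'') : OuterHom H H'' :=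
  Quotient.map₂ (sa := innerSetoid H H') (sb := innerSetoid H' H'') (sc := innerSetoid H H'') (fun φ ψ => ψ.comp φ)
    (by
      rintro φ φ' ⟨c, hc⟩ ψ ψ' ⟨c', hc'⟩
      refine ⟨c' * ψ c, fun x => ?_⟩
      change ψ' (φ' x) = (c' * ψ c) * ψ (φ x) * (c' * ψ c)⁻¹
      rw [hc x, hc', map_mul, map_mul, map_inv]; group)
    f g

/-- `comp` on representatives. ([IUTchI] §0 p.33) [claim: Mochizuki2012, status: disputed] -/
@[simp] theorem comp_ofHom (φ : H →* H') (ψ : H' →* H'') : (ofHom φ).comp (ofHom ψ) = ofHom (ψ.comp φ) := rfl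

/-- Left identity. ([IUTchI] §0 p.33) [claim: Mochizuki2012, status: disputed] -/
theorem id_comp (f : OuterHom H H') : (id H).comp f = f := by
  obtain ⟨φ, rfl⟩ := ofHom_surjective f; rfl

/-- Right identity. ([IUTchI] §0 p.33) [claim: Mochizuki2012, status: disputed] -/
theorem comp_id (f : OuterHom H H') : f.comp (id H') = f := by
  obtain ⟨φ, rfl⟩ := ofHom_surjective f; rfl

/-- Associativity. ([IUTchI] §0 p.33) [claim: Mochizuki2012, status: disputed] -/
theorem comp_assoc (f : OuterHom H H') (g : OuterHom H' H'') (k : OuterHom H'' H''') : (f.comp g).comp k = f.comp (g.comp k) := by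
  obtain ⟨φ, rfl⟩ := ofHom_surjective f
  obtain ⟨ψ, rfl⟩ := ofHom_surjective g
  obtain ⟨χ, rfl⟩ := ofHom_surjective k
  rfl

/-! ### The classes of the coset maps: conjugation-inclusions -/

/-- The homomorphism `h ↦ d⁻¹hd : H → H′` for `d⁻¹Hd ≤ H′` (the outer homomorphism underlying the coset map `xH ↦ xdH′`).
([IUTchI] §0 p.33) [claim: Mochizuki2012, status: disputed] -/
def conjHom (d : A) (hd : ∀ x ∈ H, d⁻¹ * x * d ∈ H') : H →* H' where
  toFun x := ⟨d⁻¹ * x * d, hd x x.2⟩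
  map_one' := Subtype.ext (by simp)
  map_mul' x y := Subtype.ext (by
    change d⁻¹ * (x * y : A) * d = d⁻¹ * x * d * (d⁻¹ * y * d)
    group)

/-- `conjHom d x = d⁻¹ x d`. ([IUTchI] §0 p.33) [claim: Mochizuki2012, status: disputed] -/
@[simp] theorem coe_conjHom (d : A) (hd : ∀ x ∈ H, d⁻¹ * x * d ∈ H') (x : H) : (conjHom d hd x : A) = d⁻¹ * x * d := rfl

/-- **The outer homomorphism of the coset map `xH ↦ xdH′`**: the class of `h ↦ d⁻¹hd` — INJECTIVE-type. ([IUTchI] §0 p.33) [claim: Mochizuki2012, status: disputed] -/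
def ofConj (d : A) (hd : ∀ x ∈ H, d⁻¹ * x * d ∈ H') : OuterHom H H' := ofHom (conjHom d hd)

/-- `ofConj` depends only on the coset `dH′`. ([IUTchI] §0 p.33) [claim: Mochizuki2012, status: disputed] -/
theorem ofConj_eq_of_inv_mul_mem {d d' : A} (hd : ∀ x ∈ H, d⁻¹ * x * d ∈ H') (hd' : ∀ x ∈ H, d'⁻¹ * x * d' ∈ H') (h : d⁻¹ * d' ∈ H') :
    ofConj d hd = ofConj d' hd' := by
  rw [ofConj, ofConj, ofHom_eq_ofHom_iff]
  refine ⟨⟨d⁻¹ * d', h⟩⁻¹, fun x => Subtype.ext ?_⟩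
  simp only [Subgroup.coe_mul, Subgroup.coe_inv, coe_conjHom, inv_inv]
  group

/-- The representatives of a coset class are injective homomorphisms. ([IUTchI] §0 p.33) [claim: Mochizuki2012, status: disputed] -/
theorem conjHom_injective (d : A) (hd : ∀ x ∈ H, d⁻¹ * x * d ∈ H') : Function.Injective (conjHom d hd) := by
  intro x y h
  have h' : d⁻¹ * (x : A) * d = d⁻¹ * y * d := congrArg Subtype.val h
  exact Subtype.ext (by simpa using h')

/-- `ofConj 1 = id`. ([IUTchI] §0 p.33) [claim: Mochizuki2012, status: disputed] -/
theorem ofConj_one : ofConj (H := H) (H' := H) 1 (fun x hx => by simpa using hx) = id H := by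
  rw [ofConj, id, ofHom_eq_ofHom_iff]
  exact ⟨1, fun x => Subtype.ext (by simp)⟩

/-- `ofConj` is multiplicative: the class of `x ↦ (dd′)⁻¹x(dd′)` is the composite. ([IUTchI] §0 p.33) [claim: Mochizuki2012, status: disputed] -/
theorem ofConj_comp (d d' : A) (hd : ∀ x ∈ H, d⁻¹ * x * d ∈ H') (hd' : ∀ x ∈ H', d'⁻¹ * x * d' ∈ H'')
    (hdd' : ∀ x ∈ H, (d * d')⁻¹ * x * (d * d') ∈ H'') : (ofConj d hd).comp (ofConj d' hd') = ofConj (d * d') hdd' := by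
  rw [ofConj, ofConj, ofConj, comp_ofHom, ofHom_eq_ofHom_iff]
  exact ⟨1, fun x => Subtype.ext (by change (d * d')⁻¹ * (x : A) * (d * d') = (1 : A) * (d'⁻¹ * (d⁻¹ * x * d) * d') * (1 : A)⁻¹; group)⟩

/-! ### Outer homomorphisms over an augmentation («over `G_F`», the adopted hom shape) -/

/-- **«Over `G`»**: a homomorphism `φ : H → H′` lies over the augmentation `aug : A → G` if `aug ∘ φ = c_g ∘ aug|_H` for some `g ∈ G` (morphisms of coverings
of ONE base; coset maps and the section-composites `s_j ∘ aug` both qualify). ([IUTchI] Def 3.1 (e) p.62) [claim: Mochizuki2012, status: disputed] -/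
def HomIsOver {G : Type*} [Group G] (aug : A →* G) (φ : H →* H') : Prop := ∃ g : G, ∀ x : H, aug (φ x) = g * aug x * g⁻¹

/-- Being over `G` is invariant under inner equivalence, so it descends to classes. ([IUTchI] Def 3.1 (e) p.62) [claim: Mochizuki2012, status: disputed] -/
theorem homIsOver_of_innerEquiv {G : Type*} [Group G] (aug : A →* G) {φ ψ : H →* H'} (h : InnerEquiv H H' φ ψ) (hφ : HomIsOver aug φ) :
    HomIsOver aug ψ := by
  obtain ⟨c, hc⟩ := h
  obtain ⟨g, hg⟩ := hφ
  refine ⟨aug c * g, fun x => ?_⟩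
  rw [hc x, Subgroup.coe_mul, Subgroup.coe_mul, Subgroup.coe_inv, map_mul, map_mul, map_inv, hg x]
  group

/-- **An outer homomorphism lies over `G`** if (any, equivalently every) representative does. ([IUTchI] Def 3.1 (e) p.62) [claim: Mochizuki2012, status: disputed] -/
def IsOver {G : Type*} [Group G] (aug : A →* G) (f : OuterHom H H') : Prop :=
  Quotient.liftOn (s := innerSetoid H H') f (HomIsOver aug) fun _ _ h =>
    propext ⟨homIsOver_of_innerEquiv aug h, homIsOver_of_innerEquiv aug (InnerEquiv.symm h)⟩

/-- `IsOver` on representatives. ([IUTchI] Def 3.1 (e) p.62) [claim: Mochizuki2012, status: disputed] -/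
theorem isOver_ofHom_iff {G : Type*} [Group G] (aug : A →* G) (φ : H →* H') : IsOver aug (ofHom φ) ↔ HomIsOver aug φ := Iff.rfl

/-- Coset maps lie over `G` (with `g := aug d⁻¹`). ([IUTchI] Def 3.1 (e) p.62) [claim: Mochizuki2012, status: disputed] -/
theorem isOver_ofConj {G : Type*} [Group G] (aug : A →* G) (d : A) (hd : ∀ x ∈ H, d⁻¹ * x * d ∈ H') : IsOver aug (ofConj d hd) := by
  rw [ofConj, isOver_ofHom_iff]
  exact ⟨aug d⁻¹, fun x => by rw [coe_conjHom, map_mul, map_mul, map_inv, inv_inv]⟩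

/-- A section-composite `s ∘ (aug|_H)` with `aug ∘ s = id` lies over `G` (with `g := 1`) — the shape of Example 4.4's `φ^Θ_{v̲_j}`.
([IUTchI] Ex 4.4 (i) p.106) [claim: Mochizuki2012, status: disputed] -/
theorem isOver_ofHom_section_comp {G : Type*} [Group G] (aug : A →* G) {Q : Subgroup G} (hQ : ∀ x : H, aug x ∈ Q) (s : Q →* H')
    (hs : ∀ q : Q, aug (s q) = q) :
    IsOver aug (ofHom (s.comp ((aug.comp H.subtype).codRestrict Q hQ))) := by
  rw [isOver_ofHom_iff]
  exact ⟨1, fun x => by rw [MonoidHom.comp_apply, hs]; simp⟩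

/-! ### Faithfulness under slimness; the rigidity binder -/

/-- **Faithfulness of the passage to outer homomorphisms under SLIMNESS**: if `H` has trivial centraliser in `A` (print: `Π_v̲` is slim), two coset maps
`xH ↦ xdH′`, `xH ↦ xd′H′` with the same outer homomorphism have `d⁻¹d′ ∈ H′` (the same morphism of the orbit category).
([IUTchI] §0 p.33) [claim: Mochizuki2012, status: disputed] -/
theorem inv_mul_mem_of_ofConj_eq (hZ : Subgroup.centralizer (H : Set A) = ⊥) {d d' : A} (hd : ∀ x ∈ H, d⁻¹ * x * d ∈ H')
    (hd' : ∀ x ∈ H, d'⁻¹ * x * d' ∈ H') (h : ofConj d hd = ofConj d' hd') : d⁻¹ * d' ∈ H' := by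
  rw [ofConj, ofConj, ofHom_eq_ofHom_iff] at h
  obtain ⟨c, hc⟩ := h
  -- `z := d′ c d⁻¹` centralises `H`
  have hz : d' * (c : A) * d⁻¹ ∈ Subgroup.centralizer (H : Set A) := by
    rw [Subgroup.mem_centralizer_iff]
    intro x hx
    have h1 : d'⁻¹ * x * d' = (c : A) * (d⁻¹ * x * d) * (c : A)⁻¹ := by
      have := congrArg Subtype.val (hc ⟨x, hx⟩)
      simpa using this
    calc x * (d' * (c : A) * d⁻¹) = d' * (d'⁻¹ * x * d') * (c : A) * d⁻¹ := by group
      _ = d' * ((c : A) * (d⁻¹ * x * d) * (c : A)⁻¹) * (c : A) * d⁻¹ := by rw [h1]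
      _ = d' * (c : A) * d⁻¹ * x := by group
  rw [hZ, Subgroup.mem_bot] at hz
  have hd'eq : d' = d * (c : A)⁻¹ := by
    calc d' = d' * (c : A) * d⁻¹ * d * (c : A)⁻¹ := by group
      _ = d * (c : A)⁻¹ := by rw [hz, one_mul]
  rw [hd'eq, ← mul_assoc, inv_mul_cancel, one_mul]
  exact H'.inv_mem c.2

/-- An outer homomorphism is an OUTER ISOMORPHISM if it has a two-sided inverse. ([IUTchI] §0 p.33) [claim: Mochizuki2012, status: disputed] -/
def IsOuterIso (f : OuterHom H H') : Prop := ∃ g : OuterHom H' H, f.comp g = id H ∧ g.comp f = id H'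

/-- **The RIGIDITY binder shape `OuterRigid`** (a PREDICATE, never asserted): every outer isomorphism between objects IN PLAY is the class of a coset isomorphism
of the orbit category — print: automorphisms of `†𝒟_v̲`, `†𝒟_v̲^±`, `†𝒟^{⊚±}` are the «functorial» ones of Def 6.1 (ii)/(iii) ([AbsTopIII] Thm 1.9, [EtTh] Prop 2.4).
([IUTchI] Def 6.1 (ii) p.156) [claim: Mochizuki2012, status: disputed] -/
def OuterRigid (InPlay : Subgroup A → Prop) : Prop :=
  ∀ ⦃H H' : Subgroup A⦄, InPlay H → InPlay H' → ∀ f : OuterHom H H', f.IsOuterIso →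
    ∃ (d : A) (hd : ∀ x ∈ H, d⁻¹ * x * d ∈ H'), f = ofConj d hd

end OuterHom

/-! ### From the orbit category to outer homomorphisms -/

namespace OrbitCat

/-- **The comparison `OrbitCat ⟶ outer homomorphisms`**: a morphism `xH ↦ xdH′` of the orbit category ↦ the class of `h ↦ d⁻¹hd` (well defined:
`exists_eq_homOfElem` + `ofConj_eq_of_inv_mul_mem`). ([IUTchI] §0 p.33) [claim: Mochizuki2012, status: disputed] -/
noncomputable def toOuter {H H' : Subgroup A} (f : (of H : OrbitCat A) ⟶ of H') : OuterHom H H' :=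
  OuterHom.ofConj (exists_eq_homOfElem f).choose (exists_eq_homOfElem f).choose_spec.1

/-- `toOuter (xH ↦ xdH′) = [h ↦ d⁻¹hd]`. ([IUTchI] §0 p.33) [claim: Mochizuki2012, status: disputed] -/
theorem toOuter_homOfElem {H H' : Subgroup A} (d : A) (hd : ∀ x ∈ H, d⁻¹ * x * d ∈ H') :
    toOuter (homOfElem d hd) = OuterHom.ofConj d hd := by
  have hspec := (exists_eq_homOfElem (homOfElem (H := H) (K := H') d hd)).choose_spec
  obtain ⟨hd₀, he⟩ := hspec
  refine OuterHom.ofConj_eq_of_inv_mul_mem _ hd ?_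
  -- evaluate both coset maps at `1·H`
  have h1 := congrArg (fun φ => fn φ (QuotientGroup.mk (1 : A))) he
  simp only [fn_homOfElem, one_mul] at h1
  exact QuotientGroup.eq.mp h1.symm

/-- `toOuter` is compatible with composition. ([IUTchI] §0 p.33) [claim: Mochizuki2012, status: disputed] -/
theorem toOuter_comp {H H' H'' : Subgroup A} (f : (of H : OrbitCat A) ⟶ of H') (g : (of H' : OrbitCat A) ⟶ of H'') :
    toOuter (f ≫ g) = (toOuter f).comp (toOuter g) := by
  obtain ⟨d, hd, rfl⟩ := exists_eq_homOfElem f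
  obtain ⟨d', hd', rfl⟩ := exists_eq_homOfElem g
  have hdd' : ∀ x ∈ H, (d * d')⁻¹ * x * (d * d') ∈ H'' := fun x hx => by
    have := hd' _ (hd x hx)
    simpa [mul_assoc, mul_inv_rev] using this
  have he : homOfElem d hd ≫ homOfElem d' hd' = homOfElem (H := H) (K := H'') (d * d') hdd' :=
    hom_ext_fn (funext fun q => Quotient.inductionOn' q fun x => by
      change fn (homOfElem d hd ≫ homOfElem d' hd') (QuotientGroup.mk x) = QuotientGroup.mk (x * (d * d'))
      rw [fn_comp, Function.comp_apply, fn_homOfElem, fn_homOfElem, mul_assoc])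
  rw [he, toOuter_homOfElem, toOuter_homOfElem, toOuter_homOfElem, OuterHom.ofConj_comp]

/-- `toOuter (𝟙) = id`. ([IUTchI] §0 p.33) [claim: Mochizuki2012, status: disputed] -/
theorem toOuter_id (H : Subgroup A) : toOuter (𝟙 (of H : OrbitCat A)) = OuterHom.id H := by
  have he : (𝟙 (of H : OrbitCat A)) = homOfElem (H := H) (K := H) 1 (fun x hx => by simpa using hx) :=
    hom_ext_fn (funext fun q => Quotient.inductionOn' q fun x => by
      change QuotientGroup.mk x = QuotientGroup.mk (x * 1)
      rw [mul_one])
  rw [he, toOuter_homOfElem, OuterHom.ofConj_one]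

/-- **`toOuter` is FAITHFUL under slimness** (trivial centraliser of the source). ([IUTchI] §0 p.33) [claim: Mochizuki2012, status: disputed] -/
theorem toOuter_injective_of_centralizer_eq_bot {H H' : Subgroup A} (hZ : Subgroup.centralizer (H : Set A) = ⊥) :
    Function.Injective (toOuter : ((of H : OrbitCat A) ⟶ of H') → OuterHom H H') := by
  intro f g hfg
  obtain ⟨d, hd, rfl⟩ := exists_eq_homOfElem f
  obtain ⟨d', hd', rfl⟩ := exists_eq_homOfElem g
  rw [toOuter_homOfElem, toOuter_homOfElem] at hfg
  have hmem := OuterHom.inv_mul_mem_of_ofConj_eq hZ hd hd' hfg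
  apply hom_ext_fn
  funext q
  induction q using Quotient.inductionOn' with
  | h x =>
    rw [fn_homOfElem, fn_homOfElem]
    exact QuotientGroup.eq.mpr (by simpa [mul_assoc] using hmem)

/-- Every morphism of the orbit category is INJECTIVE-type as an outer homomorphism (it is the class of an injective representative) — the kernel
complement is abc-iut-w4-d054's obstruction file. ([IUTchI] Ex 4.4 (i) p.106) [claim: Mochizuki2012, status: disputed] -/
theorem exists_injective_rep_toOuter {H H' : Subgroup A} (f : (of H : OrbitCat A) ⟶ of H') :
    ∃ φ : H →* H', OuterHom.ofHom φ = toOuter f ∧ Function.Injective φ := by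
  obtain ⟨d, hd, rfl⟩ := exists_eq_homOfElem f
  exact ⟨OuterHom.conjHom d hd, (toOuter_homOfElem d hd).symm, OuterHom.conjHom_injective d hd⟩

end OrbitCat

end Literature.IUT.HodgeTheaters
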